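import Summits.QuantumFields.YangMills.Theorems.FluctuationComparisonRegPrIntLS2BetaMinActionRegPrContinuousOn
import Literature.MathematicalPhysics.QuantumFieldTheory.Balaban1983to89.T3AlphaInputsAC
import HarnessLib

/-!
# S1a · UV3-NODE §69.10 — THE δ7 BINDER `hlowc` REDUCED TO ITS PRINTED CORE: `low K k` IS CONTINUOUS ON THE WINDOW as soon as the trivial-history INTERACTION `Pint(triv, ·)` is
# (print p.263 (c) «analyticity … ⟹ continuity»), for `L ≥ 5` — the main term is `β_K·minActionRegPr` by `UminTrivIsRegMinimiser`, continuous on the window by the tree's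
# hypothesis-free ✓`continuousOn_minActionRegPr_five` ([Balaban1985Variational] Thm 1 (8) a tree THEOREM for `L ≥ 5`)

Cell `ym3-torus` (YM ladder rung R3 = continuum `SU(2)` Yang–Mills on the three-torus — a RUNG: NOT d = 4, NOT infinite volume, NOT a mass gap, NOT Clay).
Width seat «width 8» `ym3-torus-px8` (gen 23), FREE px helper on crux `stmt-QuantumFields-20520`, count-neutral, DEFINITION-FREE, default heartbeats; a reduction of the binder `hlowc :
ContinuousOn (D.low K k) {PlaqSmall θBal(K−k)}` of ✓p822781 `…S1aAlphaMemCanonVersionOfRows.mem_canonVersion_of_alphaRows`.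

WHAT (run `K`, level `k < K`, `n := K − k` the height, block size `L = F.L ≥ 5`):
* §1 `mainT_triv_eq_minActionRegPr` — under `MainTermIsAction` + `UminTrivIsRegMinimiser`, on the window: `mainT K k triv W = β_K · minActionRegPr F (K−k) K _ ε₀ (fieldShift⁻¹ W)`;
  `continuousOn_mainT_triv` — hence `ContinuousOn (mainT K k triv) {PlaqSmall θBal(K−k)}` whenever `V ↦ minActionRegPr … V` is continuous on `{PlaqSmall θBal(K−k)}` (the tree's
  ✓`continuousOn_minActionRegPr_five` supplies this for `L ≥ 5`, `0 < θBal(K−k) ≤ a₁`, `B₃·θBal(K−k) < ε₀ ≤ e` — numerics on `(γ, b₀, p₀, ε₀)`, displayed).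
* §2 ★★ `continuousOn_low_of_pint` — `hlowc` FROM: `ChiOneOnSmall`-at-`(K,k)` (`χ = 1` on the window), `MainTermIsAction`, `UminTrivIsRegMinimiser`, the `L ≥ 5` window continuity of
  `minActionRegPr`, and THE ONE PRINTED RESIDUAL `hPintc : ContinuousOn (D.Pint K k (D.triv K k)) {PlaqSmall θBal(K−k)}` — print p.263 (c) «The third property is the analyticity
  with respect to U₁» for the activities (⟹ continuity of their sum at the continuously-varying background); the (C-an) lane's content, NOT a schema of the socket.
So in ✓p822781's binder list «`low` continuous on the window» is replaced by «`Pint(triv, ·)` continuous on the window» + `L ≥ 5` numerics; `hupc` (the LF functional's majorant) is untouched.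

WHAT THIS FILE IS NOT: continuity of `Pint` or `up`; anything for `L = 3`; nothing of Bałaban's asserted or proved beyond the tree's Thm-1-for-`L ≥ 5`; 20520 ∕ `YM3TorusSU2` NOT proved;
rung R3 = SU(2) YM₃ on T³ — NOT d = 4, NOT infinite volume, NOT a mass gap, NOT Clay.  Sorry-free, axioms standard.

References: T. Bałaban, CMP **102** (1985) 255–275 [Balaban1985UV3] ((41)–(47) pp.266–267, p.263); CMP **102** (1985) 277–309 [Balaban1985Variational] (Thm 1 (8) p.279, Prop 9 p.309).
-/

set_option autoImplicit false

noncomputable section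

namespace Summit.QuantumFields.YangMills.Theorems.FluctuationComparisonRegPrIntLS1aAlphaLowContinuous

open Set Filter Topology
open Literature.MathematicalPhysics.QuantumFieldTheory.Balaban1983to89
open T3ContinuumYM3Torus T3LevelShift T3UnitScaleTilt T3UnitLawDensityEML T3PrintedRegularMinimiser T3AlphaInputsAC

variable {F : T3Family} {γ : ℝ}

/-! ## §1 The main term at the trivial history is `β_K · minActionRegPr`, continuous on the window when the latter is -/

/-- The level identification is continuous (a coordinate reindexing). [cite: Balaban1987RG1, (0.1) p.251] -/
private theorem continuous_fieldShift' {m K j m' K' j' : ℕ} {G : Type*} [TopologicalSpace G]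
    (h : (F.PP m K).sitesPerDir j = (F.PP m' K').sitesPerDir j') :
    Continuous (fieldShift h : GaugeField (F.PP m' K') j' G → GaugeField (F.PP m K) j G) :=
  continuous_pi fun _ => continuous_apply _

/-- **THE MAIN TERM AT THE TRIVIAL HISTORY ON THE WINDOW**: `mainT K (K−n) triv W = β_K · minActionRegPr F n K _ ε₀ (fieldShift⁻¹ W)` for every `θBal(n)`-small `W`
(`MainTermIsAction` + `UminTrivIsRegMinimiser`'s action clause). [cite: Balaban1985UV3, (41) p.266; Balaban1985Variational, Thm 1 (8) p.279] -/
theorem mainT_triv_eq_minActionRegPr (D : AlphaDataT3 F γ) {b₀ p₀ ε₀ : ℝ} (hM : MainTermIsAction D) (hU : UminTrivIsRegMinimiser D b₀ p₀ ε₀)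
    {K n : ℕ} (h : n ≤ K) (W : GaugeField (F.P K) (K - n) (Matrix.specialUnitaryGroup (Fin 2) ℂ)) (hW : PlaqSmall (θBal F.L γ b₀ p₀ n) W) :
    D.mainT K (K - n) (D.triv K (K - n)) W =
      (F.scheme ℰp γ).β K * minActionRegPr F n K h ε₀
        (fieldShift (F.sitesPerDir_eq (m := F.m) (K := K) (j := K - n) (m' := F.m) (K' := n) (j' := 0) (by omega)).symm W) := by
  set e := F.sitesPerDir_eq (m := F.m) (K := K) (j := K - n) (m' := F.m) (K' := n) (j' := 0) (by omega) with he
  have hWV : fieldShift e (fieldShift e.symm W) = W := fieldShift_symm_fieldShift e W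
  have hV : PlaqSmall (θBal F.L γ b₀ p₀ n) (fieldShift e.symm W) := fun p => by
    rw [plaqHol_fieldShift]; exact hW _
  have hact := (hU K n h (fieldShift e.symm W) hV).2
  rw [hWV] at hact
  rw [hM K (K - n) (D.triv K (K - n)) W, hact]

/-- **CONTINUITY OF THE MAIN TERM ON THE WINDOW** from the window continuity of `minActionRegPr` (composition with the continuous level identification; the window is
mapped into itself). [cite: Balaban1985Variational, Prop 9 p.309] -/
theorem continuousOn_mainT_triv (D : AlphaDataT3 F γ) {b₀ p₀ ε₀ : ℝ} (hM : MainTermIsAction D) (hU : UminTrivIsRegMinimiser D b₀ p₀ ε₀)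
    {K n : ℕ} (h : n ≤ K)
    (hmin : ContinuousOn (minActionRegPr F n K h ε₀) {V | PlaqSmall (θBal F.L γ b₀ p₀ n) V}) :
    ContinuousOn (fun W => D.mainT K (K - n) (D.triv K (K - n)) W) {W | PlaqSmall (θBal F.L γ b₀ p₀ n) W} := by
  set e := F.sitesPerDir_eq (m := F.m) (K := K) (j := K - n) (m' := F.m) (K' := n) (j' := 0) (by omega) with he
  have hmaps : MapsTo (fieldShift e.symm : GaugeField (F.P K) (K - n) (Matrix.specialUnitaryGroup (Fin 2) ℂ) → _)
      {W | PlaqSmall (θBal F.L γ b₀ p₀ n) W} {V | PlaqSmall (θBal F.L γ b₀ p₀ n) V} := fun W hW p => by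
    show GaugeGroup.dist1 (GaugeField.plaqHol (fieldShift e.symm W) p) < _
    rw [plaqHol_fieldShift]; exact hW _
  have hcomp : ContinuousOn (fun W => (F.scheme ℰp γ).β K * minActionRegPr F n K h ε₀ (fieldShift e.symm W))
      {W | PlaqSmall (θBal F.L γ b₀ p₀ n) W} :=
    continuousOn_const.mul (hmin.comp (continuous_fieldShift' e.symm).continuousOn hmaps)
  exact hcomp.congr fun W hW => mainT_triv_eq_minActionRegPr D hM hU h W hW

/-! ## §2 `low` is continuous on the window once `Pint(triv, ·)` is -/

/-- ★★ **THE δ7 BINDER `hlowc` FROM ITS PRINTED CORE** (run `K`, height `n ≤ K`, level `K − n`): if `χ = 1` on the `θBal(n)`-window (δ8 at `(K, K−n)`), `MainTermIsAction`,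
`UminTrivIsRegMinimiser`, `V ↦ minActionRegPr F n K _ ε₀ V` is continuous on `{PlaqSmall θBal(n)}` (✓`continuousOn_minActionRegPr_five` for `L ≥ 5` under its numerics) and the
trivial-history interaction `Pint K (K−n) triv` is continuous on the window (print p.263 (c)), then `low K (K−n) = χ·exp(−mainT(triv) + Pint(triv))` is continuous on the window —
✓p822781's `hlowc`. [cite: Balaban1985UV3, (47) p.267 and p.263] -/
theorem continuousOn_low_of_pint (D : AlphaDataT3 F γ) {b₀ p₀ ε₀ : ℝ} (hM : MainTermIsAction D) (hU : UminTrivIsRegMinimiser D b₀ p₀ ε₀)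
    {K n : ℕ} (h : n ≤ K)
    (hχ1 : ∀ W : GaugeField (F.P K) (K - n) (Matrix.specialUnitaryGroup (Fin 2) ℂ), PlaqSmall (θBal F.L γ b₀ p₀ n) W → D.χ K (K - n) W = 1)
    (hmin : ContinuousOn (minActionRegPr F n K h ε₀) {V | PlaqSmall (θBal F.L γ b₀ p₀ n) V})
    (hPintc : ContinuousOn (fun W => D.Pint K (K - n) (D.triv K (K - n)) W) {W | PlaqSmall (θBal F.L γ b₀ p₀ n) W}) :
    ContinuousOn (D.low K (K - n)) {W | PlaqSmall (θBal F.L γ b₀ p₀ n) W} := by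
  have hexp : ContinuousOn (fun W => Real.exp (-(D.mainT K (K - n) (D.triv K (K - n)) W) + D.Pint K (K - n) (D.triv K (K - n)) W))
      {W | PlaqSmall (θBal F.L γ b₀ p₀ n) W} :=
    Real.continuous_exp.comp_continuousOn (((continuousOn_mainT_triv D hM hU h hmin).neg).add hPintc)
  refine hexp.congr fun W hW => ?_
  show D.χ K (K - n) W * Real.exp (-(D.mainT K (K - n) (D.triv K (K - n)) W) + D.Pint K (K - n) (D.triv K (K - n)) W) = _
  rw [hχ1 W hW, one_mul]

/-- ★★ **THE SAME WITH THE TREE's `L ≥ 5` WINDOW CONTINUITY PLUGGED IN** (numerics displayed): with `hfive` := the `∀`-clause of ✓`continuousOn_minActionRegPr_five F.L h5`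
(`5 ≤ F.L`) for its constants `a₁, B₃, e`, if `0 < θBal(n) ≤ a₁` and `B₃·θBal(n) < ε₀ ≤ e`, then `hlowc` follows from `χ = 1` on the window, `MainTermIsAction`, `UminTrivIsRegMinimiser`
and the continuity of `Pint(triv, ·)` on the window alone. [cite: Balaban1985Variational, Thm 1 (8) p.279 and Prop 9 p.309] -/
theorem continuousOn_low_of_pint_five (D : AlphaDataT3 F γ) {b₀ p₀ ε₀ : ℝ} (hM : MainTermIsAction D) (hU : UminTrivIsRegMinimiser D b₀ p₀ ε₀)
    {K n : ℕ} (hnK : n < K)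
    {a₁ B₃ e : ℝ}
    (hfive : ∀ (F' : T3Family), F'.L = F.L → ∀ {n' K' : ℕ} (hnK' : n' < K') (ε₁ ε₀' : ℝ),
      0 < ε₁ → ε₁ ≤ a₁ → B₃ * ε₁ < ε₀' → ε₀' ≤ e → ContinuousOn (minActionRegPr F' n' K' hnK'.le ε₀') {V | PlaqSmall ε₁ V})
    (hθ0 : 0 < θBal F.L γ b₀ p₀ n) (hθa : θBal F.L γ b₀ p₀ n ≤ a₁) (hBε : B₃ * θBal F.L γ b₀ p₀ n < ε₀) (hεe : ε₀ ≤ e)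
    (hχ1 : ∀ W : GaugeField (F.P K) (K - n) (Matrix.specialUnitaryGroup (Fin 2) ℂ), PlaqSmall (θBal F.L γ b₀ p₀ n) W → D.χ K (K - n) W = 1)
    (hPintc : ContinuousOn (fun W => D.Pint K (K - n) (D.triv K (K - n)) W) {W | PlaqSmall (θBal F.L γ b₀ p₀ n) W}) :
    ContinuousOn (D.low K (K - n)) {W | PlaqSmall (θBal F.L γ b₀ p₀ n) W} := by
  exact continuousOn_low_of_pint D hM hU hnK.le hχ1 (hfive F rfl hnK _ _ hθ0 hθa hBε hεe) hPintc

end Summit.QuantumFields.YangMills.Theorems.FluctuationComparisonRegPrIntLS1aAlphaLowContinuous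

end
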